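import Summits.KontsevichZagierPeriods.KontsevichZagierPeriods.Theorems.HurwitzMicroSectorsNormalFormPrincipleM3KernelRefs
import Summits.KontsevichZagierPeriods.KontsevichZagierPeriods.Theorems.HurwitzMicroSectorsNormalFormPrincipleM3KernelReduceZeta
import Summits.KontsevichZagierPeriods.KontsevichZagierPeriods.Theorems.HurwitzMicroSectorsNormalFormPrincipleM4KernelReduceZeta
import Summits.KontsevichZagierPeriods.KontsevichZagierPeriods.Theorems.HurwitzMicroSectorsNormalFormPrincipleM4NegZetaThreeBox
import Summits.KontsevichZagierPeriods.KontsevichZagierPeriods.Theorems.HurwitzMicroSectorsNormalFormPrincipleLevelOneBoxPolyExistsPt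
import Summits.KontsevichZagierPeriods.KontsevichZagierPeriods.Theorems.MzvKernelInKZ.Negative.ScalingDivision
import Literature.NumberTheory.Transcendental.AperyIrrationality

/-!
# `NormalFormPrinciple` (stmt-KontsevichZagierPeriods-3869), line `SketchIdeator1` —
# leaf `stub_boxRigidity`: the Apéry kernel, II — eight `ζ(3)` families and the polynomial boxes

Pure proof file (lead seat c9; `--supports` the crux). Extension of the unconditional Apéry kernel
`m3ZetaFamiliesPoly_mem_relations_of_eval_eq_zero` by the two `η(3)`-type families `[□³, 1/(1+xyz)]`
(`(3/4)ζ(3)`) and `[□³, 4/(1+xyz)]` (`3ζ(3)`), which the box form of the weight-three relation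
`3[aab] = 4[aac]` (`m4_negZetaThree_box`) ties to the `ζ(3)` box; the normal form now runs with the
factor `4`: `4[c] ≡ α[ζ(3) box] + [pt, q]`, value `α ζ(3) + q`, Apéry kills `α`, then `q`.
References: M. Kontsevich, D. Zagier, *Periods* (2001), §1.2 (Conjecture 1); R. Apéry (1979).
No definitions are introduced.
-/

noncomputable section

open MeasureTheory Set
open Literature.NumberTheory.Transcendental Literature.NumberTheory.Transcendental.KZ
open Summit.KontsevichZagierPeriods.MzvKernelInKZ.Negative (mem_relations_of_nsmul_mem)
open Summit.KontsevichZagierPeriods.HurwitzMicroSectors.NormalFormPrinciple.PiBox.Dlog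
  (exists_ptCarrier value_pt pt_add_mem_relations pt_zero_mem_relations)
open Summit.KontsevichZagierPeriods.HurwitzMicroSectors.NormalFormPrinciple.PiBox.LevelOne
  (boxPoly_exists_pt)

namespace Summit.KontsevichZagierPeriods.HurwitzMicroSectors.NormalFormPrinciple.PiBox.M3

/-- **Conjecture 1 UNCONDITIONALLY on eight `ζ(3)`-valued dimension-three box families together
with all rational polynomial boxes** (lead seat c9, line `SketchIdeator1`): the six families of the
Apéry kernel, `[□³, 1/(1+xyz)]` and `[□³, 4/(1+xyz)]`; a formal `ℤ`-combination of their
representatives and of polynomial boxes `[□ᵐ, p]` with vanishing value is a KZ relation (Apéry).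
[cite: KontsevichZagier2001, §1.2 Conjecture 1] -/
theorem m3ZetaEightFamiliesPoly_mem_relations_of_eval_eq_zero
    {c : FormalRep}
    (hc : c ∈ AddSubgroup.closure
      ({y : FormalRep | ∃ N : IntegralRep 3, N.domain = {x | ∀ i, x i ∈ Set.Ioo (0:ℝ) 1} ∧
        EqOn N.integrand (fun x => 1 / (1 - x 0 * x 1 * x 2)) N.domain ∧ y = of N} ∪
      {y : FormalRep | ∃ N : IntegralRep 3, N.domain = {x | ∀ i, x i ∈ Set.Ioo (0:ℝ) 1} ∧
        EqOn N.integrand (fun x => 2 / (1 - x 0 * x 1 * x 2)) N.domain ∧ y = of N} ∪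
      {y : FormalRep | ∃ N : IntegralRep 3, N.domain = {x | ∀ i, x i ∈ Set.Ioo (0:ℝ) 1} ∧
        EqOn N.integrand (fun x => 5 / (1 - x 0 * x 1 * x 2)) N.domain ∧ y = of N} ∪
      {y : FormalRep | ∃ N : IntegralRep 3, N.domain = {x | ∀ i, x i ∈ Set.Ioo (0:ℝ) 1} ∧
        EqOn N.integrand (fun x => 1 / ((1 - x 0 * x 1) * (1 - x 0 * x 1 * x 2))) N.domain ∧ y = of N} ∪
      {y : FormalRep | ∃ N : IntegralRep 3, N.domain = {x | ∀ i, x i ∈ Set.Ioo (0:ℝ) 1} ∧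
        EqOn N.integrand (fun x => 8 / ((1 + x 0 * x 1) * (1 + x 0 * x 1 * x 2))) N.domain ∧ y = of N} ∪
      {y : FormalRep | ∃ N : IntegralRep 3, N.domain = {x | ∀ i, x i ∈ Set.Ioo (0:ℝ) 1} ∧
        EqOn N.integrand (fun x => 16 / ((2 - x 0) * (2 - x 0 * x 1 * x 2))) N.domain ∧ y = of N} ∪
      {y : FormalRep | ∃ N : IntegralRep 3, N.domain = {x | ∀ i, x i ∈ Set.Ioo (0:ℝ) 1} ∧
        EqOn N.integrand (fun x => 1 / (1 + x 0 * x 1 * x 2)) N.domain ∧ y = of N} ∪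
      {y : FormalRep | ∃ N : IntegralRep 3, N.domain = {x | ∀ i, x i ∈ Set.Ioo (0:ℝ) 1} ∧
        EqOn N.integrand (fun x => 4 / (1 + x 0 * x 1 * x 2)) N.domain ∧ y = of N} ∪
      {y : FormalRep | ∃ (m : ℕ) (p : MvPolynomial (Fin m) ℚ) (N : IntegralRep m),
        N.domain = {x | ∀ i, x i ∈ Set.Ioo (0:ℝ) 1} ∧
        EqOn N.integrand (fun x => (MvPolynomial.aeval x p : ℝ)) N.domain ∧ y = of N}))
    (hv : eval c = 0) : c ∈ relations := by
  obtain ⟨Z, Q, N7, ⟨hZd, hZi, hZv⟩, ⟨hQd, hQi, hQv⟩, ⟨hN7d, hN7i⟩⟩ := m3k_exists_refs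
  obtain ⟨r10, r2, r4, r1, r3, r5⟩ := m3k_reduce_zeta Z Q N7 hZd hZi hQd hQi hN7d hN7i
  obtain ⟨Zf, hZf⟩ := exists_ptCarrier
  have hZ0 : of (Zf 0) ∈ relations :=
    pt_zero_mem_relations (Zf 0) (by rw [(hZf 0).2]; push_cast; rfl)
  have hadd : ∀ q q' : ℚ, of (Zf (q + q')) - of (Zf q) - of (Zf q') ∈ relations := fun q q' =>
    pt_add_mem_relations (Zf (q + q')) (Zf q) (Zf q') (hZf _).1 (hZf _).1 (hZf _).1
      (by rw [(hZf _).2]; push_cast; rfl) (hZf _).2 (hZf _).2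
  have hred : ∀ c ∈ AddSubgroup.closure
      ({y : FormalRep | ∃ N : IntegralRep 3, N.domain = {x | ∀ i, x i ∈ Set.Ioo (0:ℝ) 1} ∧
        EqOn N.integrand (fun x => 1 / (1 - x 0 * x 1 * x 2)) N.domain ∧ y = of N} ∪
      {y : FormalRep | ∃ N : IntegralRep 3, N.domain = {x | ∀ i, x i ∈ Set.Ioo (0:ℝ) 1} ∧
        EqOn N.integrand (fun x => 2 / (1 - x 0 * x 1 * x 2)) N.domain ∧ y = of N} ∪
      {y : FormalRep | ∃ N : IntegralRep 3, N.domain = {x | ∀ i, x i ∈ Set.Ioo (0:ℝ) 1} ∧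
        EqOn N.integrand (fun x => 5 / (1 - x 0 * x 1 * x 2)) N.domain ∧ y = of N} ∪
      {y : FormalRep | ∃ N : IntegralRep 3, N.domain = {x | ∀ i, x i ∈ Set.Ioo (0:ℝ) 1} ∧
        EqOn N.integrand (fun x => 1 / ((1 - x 0 * x 1) * (1 - x 0 * x 1 * x 2))) N.domain ∧ y = of N} ∪
      {y : FormalRep | ∃ N : IntegralRep 3, N.domain = {x | ∀ i, x i ∈ Set.Ioo (0:ℝ) 1} ∧
        EqOn N.integrand (fun x => 8 / ((1 + x 0 * x 1) * (1 + x 0 * x 1 * x 2))) N.domain ∧ y = of N} ∪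
      {y : FormalRep | ∃ N : IntegralRep 3, N.domain = {x | ∀ i, x i ∈ Set.Ioo (0:ℝ) 1} ∧
        EqOn N.integrand (fun x => 16 / ((2 - x 0) * (2 - x 0 * x 1 * x 2))) N.domain ∧ y = of N} ∪
      {y : FormalRep | ∃ N : IntegralRep 3, N.domain = {x | ∀ i, x i ∈ Set.Ioo (0:ℝ) 1} ∧
        EqOn N.integrand (fun x => 1 / (1 + x 0 * x 1 * x 2)) N.domain ∧ y = of N} ∪
      {y : FormalRep | ∃ N : IntegralRep 3, N.domain = {x | ∀ i, x i ∈ Set.Ioo (0:ℝ) 1} ∧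
        EqOn N.integrand (fun x => 4 / (1 + x 0 * x 1 * x 2)) N.domain ∧ y = of N} ∪
      {y : FormalRep | ∃ (m : ℕ) (p : MvPolynomial (Fin m) ℚ) (N : IntegralRep m),
        N.domain = {x | ∀ i, x i ∈ Set.Ioo (0:ℝ) 1} ∧
        EqOn N.integrand (fun x => (MvPolynomial.aeval x p : ℝ)) N.domain ∧ y = of N}),
      ∃ (α : ℤ) (q : ℚ), (4:ℕ) • c - (α • of Z + of (Zf q)) ∈ relations := by
    intro c hc
    induction hc using AddSubgroup.closure_induction with
    | mem y hy =>
      simp only [mem_union, mem_setOf_eq] at hy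
      rcases hy with ((((((((⟨N, hNd, hNi, rfl⟩ | ⟨N, hNd, hNi, rfl⟩) | ⟨N, hNd, hNi, rfl⟩) | ⟨N, hNd, hNi, rfl⟩) | ⟨N, hNd, hNi, rfl⟩) | ⟨N, hNd, hNi, rfl⟩) | ⟨N, hNd, hNi, rfl⟩) | ⟨N, hNd, hNi, rfl⟩) | ⟨m, p, N, hNd, hNi, rfl⟩)
      · refine ⟨4, 0, ?_⟩
        have h := r10 N hNd hNi
        have e : (4:ℕ) • of N - ((4:ℤ) • of Z + of (Zf 0)) =
            (2:ℕ) • ((2:ℕ) • of N - ((2:ℤ) • of Z + (0:ℤ) • of Q)) - of (Zf 0) := by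
          simp only [zero_smul, add_zero, smul_sub, smul_smul]; norm_num
          simp only [show (4:ℕ) = 2 * 2 from rfl, mul_nsmul]; abel
        rw [e]
        exact relations.sub_mem (relations.nsmul_mem h 2) hZ0
      · refine ⟨8, 0, ?_⟩
        have h := r2 N hNd hNi
        have e : (4:ℕ) • of N - ((8:ℤ) • of Z + of (Zf 0)) =
            (2:ℕ) • ((2:ℕ) • of N - ((4:ℤ) • of Z + (0:ℤ) • of Q)) - of (Zf 0) := by
          simp only [zero_smul, add_zero, smul_sub, smul_smul]; norm_num
          simp only [show (4:ℕ) = 2 * 2 from rfl, mul_nsmul]; abel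
        rw [e]
        exact relations.sub_mem (relations.nsmul_mem h 2) hZ0
      · refine ⟨20, 0, ?_⟩
        have h := r4 N hNd hNi
        have e : (4:ℕ) • of N - ((20:ℤ) • of Z + of (Zf 0)) =
            (2:ℕ) • ((2:ℕ) • of N - ((10:ℤ) • of Z + (0:ℤ) • of Q)) - of (Zf 0) := by
          simp only [zero_smul, add_zero, smul_sub, smul_smul]; norm_num
          simp only [show (4:ℕ) = 2 * 2 from rfl, mul_nsmul]; abel
        rw [e]
        exact relations.sub_mem (relations.nsmul_mem h 2) hZ0
      · refine ⟨8, 0, ?_⟩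
        have h := r1 N hNd hNi
        have e : (4:ℕ) • of N - ((8:ℤ) • of Z + of (Zf 0)) =
            (2:ℕ) • ((2:ℕ) • of N - ((4:ℤ) • of Z + (0:ℤ) • of Q)) - of (Zf 0) := by
          simp only [zero_smul, add_zero, smul_sub, smul_smul]; norm_num
          simp only [show (4:ℕ) = 2 * 2 from rfl, mul_nsmul]; abel
        rw [e]
        exact relations.sub_mem (relations.nsmul_mem h 2) hZ0
      · refine ⟨20, 0, ?_⟩
        have h := r3 N hNd hNi
        have e : (4:ℕ) • of N - ((20:ℤ) • of Z + of (Zf 0)) =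
            (2:ℕ) • ((2:ℕ) • of N - ((10:ℤ) • of Z + (0:ℤ) • of Q)) - of (Zf 0) := by
          simp only [zero_smul, add_zero, smul_sub, smul_smul]; norm_num
          simp only [show (4:ℕ) = 2 * 2 from rfl, mul_nsmul]; abel
        rw [e]
        exact relations.sub_mem (relations.nsmul_mem h 2) hZ0
      · refine ⟨20, 0, ?_⟩
        have h := r5 N hNd hNi
        have e : (4:ℕ) • of N - ((20:ℤ) • of Z + of (Zf 0)) =
            (2:ℕ) • ((2:ℕ) • of N - ((10:ℤ) • of Z + (0:ℤ) • of Q)) - of (Zf 0) := by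
          simp only [zero_smul, add_zero, smul_sub, smul_smul]; norm_num
          simp only [show (4:ℕ) = 2 * 2 from rfl, mul_nsmul]; abel
        rw [e]
        exact relations.sub_mem (relations.nsmul_mem h 2) hZ0
      · -- `[□³, 1/(1+xyz)]`: `4[N] ≡ 3[Z]` by `m4_negZetaThree_box` on `N.constMul 4`, `Z.constMul 3`
        refine ⟨3, 0, ?_⟩
        have h : (4:ℕ) • of N - (3:ℕ) • of Z ∈ relations :=
          m4ka_nsmul_sub_nsmul_mem N Z 4 3 (m4_negZetaThree_box _ _ (m4ka_domain_constMul N 4 hNd)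
            (m4ka_eqOn_constMul N 4 _ hNi fun x => by push_cast; ring) (m4ka_domain_constMul Z 3 hZd)
            (m4ka_eqOn_constMul Z 3 _ (fun x _ => by rw [hZi]) fun x => by push_cast; ring))
        have e : (4:ℕ) • of N - ((3:ℤ) • of Z + of (Zf 0)) = ((4:ℕ) • of N - (3:ℕ) • of Z) - of (Zf 0) := by
          abel
        rw [e]
        exact relations.sub_mem h hZ0
      · -- `[□³, 4/(1+xyz)]`: `[N] ≡ 3[Z]`
        refine ⟨12, 0, ?_⟩
        have h : (1:ℕ) • of N - (3:ℕ) • of Z ∈ relations :=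
          m4ka_nsmul_sub_nsmul_mem N Z 1 3 (m4_negZetaThree_box _ _ (m4ka_domain_constMul N 1 hNd)
            (m4ka_eqOn_constMul N 1 _ hNi fun x => by push_cast; ring) (m4ka_domain_constMul Z 3 hZd)
            (m4ka_eqOn_constMul Z 3 _ (fun x _ => by rw [hZi]) fun x => by push_cast; ring))
        have e : (4:ℕ) • of N - ((12:ℤ) • of Z + of (Zf 0)) =
            (4:ℕ) • ((1:ℕ) • of N - (3:ℕ) • of Z) - of (Zf 0) := by
          simp only [one_smul, smul_sub]; abel
        rw [e]
        exact relations.sub_mem (relations.nsmul_mem h 4) hZ0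
      · obtain ⟨q, hq⟩ := boxPoly_exists_pt p N hNd hNi
        refine ⟨0, q + q + (q + q), ?_⟩
        have h := hq (Zf q) (hZf q).1 (hZf q).2
        have e : (4:ℕ) • of N - ((0:ℤ) • of Z + of (Zf (q + q + (q + q)))) =
            ((of N - of (Zf q)) + (of N - of (Zf q)) + ((of N - of (Zf q)) + (of N - of (Zf q)))) -
              (of (Zf (q + q)) - of (Zf q) - of (Zf q)) - (of (Zf (q + q)) - of (Zf q) - of (Zf q)) -
              (of (Zf (q + q + (q + q))) - of (Zf (q + q)) - of (Zf (q + q))) := by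
          simp only [zero_smul, zero_add, show (4:ℕ) = 2 + 2 from rfl, add_nsmul, two_nsmul]; abel
        rw [e]
        exact relations.sub_mem (relations.sub_mem (relations.sub_mem
          (relations.add_mem (relations.add_mem h h) (relations.add_mem h h)) (hadd q q)) (hadd q q))
          (hadd (q + q) (q + q))
    | zero =>
      refine ⟨0, 0, ?_⟩
      have e : (4:ℕ) • (0:FormalRep) - ((0:ℤ) • of Z + of (Zf 0)) = -of (Zf 0) := by
        simp only [smul_zero, zero_smul, zero_add, zero_sub]
      rw [e]
      exact relations.neg_mem hZ0
    | add y z _ _ ihy ihz =>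
      obtain ⟨α₁, q₁, h₁⟩ := ihy
      obtain ⟨α₂, q₂, h₂⟩ := ihz
      refine ⟨α₁ + α₂, q₁ + q₂, ?_⟩
      have e : (4:ℕ) • (y + z) - ((α₁ + α₂) • of Z + of (Zf (q₁ + q₂))) =
          ((4:ℕ) • y - (α₁ • of Z + of (Zf q₁))) + ((4:ℕ) • z - (α₂ • of Z + of (Zf q₂))) -
            (of (Zf (q₁ + q₂)) - of (Zf q₁) - of (Zf q₂)) := by
        simp only [smul_add, add_smul]; abel
      rw [e]
      exact relations.sub_mem (relations.add_mem h₁ h₂) (hadd q₁ q₂)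
    | neg y _ ih =>
      obtain ⟨α, q, h⟩ := ih
      refine ⟨-α, -q, ?_⟩
      have hq0 : of (Zf (q + -q)) ∈ relations :=
        pt_zero_mem_relations _ (by rw [(hZf _).2]; push_cast; ring_nf)
      have e : (4:ℕ) • (-y) - ((-α) • of Z + of (Zf (-q))) =
          -((4:ℕ) • y - (α • of Z + of (Zf q))) + (of (Zf (q + -q)) - of (Zf q) - of (Zf (-q)))
            - of (Zf (q + -q)) := by
        simp only [smul_neg, neg_smul]; abel
      rw [e]
      exact relations.sub_mem (relations.add_mem (relations.neg_mem h) (hadd q (-q))) hq0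
  obtain ⟨α, q, h⟩ := hred c hc
  have hev := relations_le_ker_eval_holds h
  rw [AddMonoidHom.mem_ker, map_sub, map_nsmul, map_add, map_zsmul, eval_of, eval_of, hv, hZv,
    value_pt (Zf q) (hZf q).1 (hZf q).2, smul_zero, zero_sub, neg_eq_zero, zsmul_eq_mul] at hev
  have hα : α = 0 := by
    by_contra hα
    have hα' : (α : ℝ) ≠ 0 := by exact_mod_cast hα
    refine Literature.NumberTheory.Transcendental.Apery.irrational_zeta_three ⟨-q / α, ?_⟩
    push_cast
    field_simp
    linarith
  subst hα
  have hq : q = 0 := by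
    have : (q : ℝ) = 0 := by simpa using hev
    exact_mod_cast this
  subst hq
  have e : (4:ℕ) • c = ((4:ℕ) • c - ((0:ℤ) • of Z + of (Zf 0))) + of (Zf 0) := by
    simp only [zero_smul, zero_add]; abel
  refine mem_relations_of_nsmul_mem (by norm_num : 0 < 4) ?_
  rw [e]
  exact relations.add_mem h hZ0

end Summit.KontsevichZagierPeriods.HurwitzMicroSectors.NormalFormPrinciple.PiBox.M3
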